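import Summits.NavierStokesRegularity.NavierStokesRegularity.Theorems.AxisymmetricExtremalityAxisymmetricKatoGlobalStubSeregin2020TypeIILemma22MoserEnergyStep
import HarnessLib

/-!
# Seregin 2020, Lemma 2.2 (after Nazarov–Uraltseva 2012), atom M1 (`lemma22_moserStep`): the
# energy bounds — slices and dissipation of `w = η^{1/2} (l-Φ)₊^{q/2} φ³` from the energy class

Helper toward the registered stub `lemma22_moserStep` of stmt-NavierStokesRegularity-15453 (crux
`AxisymmetricKatoGlobal`; Seregin 2020 Lemma 2.2 ⇐ N–U 2012 Lemma 3.1). N–U (3.2)→(3.3) in the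
energy-class formulation (skeleton `Cruxes/AxisymmetricKatoGlobal/Seregin2020Lemma22ExpansionOfPositivity.lean`,
`EnergyClass`, written out as the hypothesis `hEC`): testing the class with `H = ((l-τ)₊)^q`
(`q > 2`), `Θ = φ³` (`φ = radialCutoff ρ₂ ρ₁`) and a time weight `η ∈ C¹`, `0 ≤ η ≤ 1`,
`|η'| ≤ B_η`, `η(t₁) M(t₁) = 0`, one gets for every `t ∈ ]t₁, t₀[`

  `∫ η(t) (l-Φ(t))₊^q φ⁶ dx ≤ E`,   `∫∫_{]t₁,t₀[×ℝ³} ½ η H''(Φ)‖∇Φ‖² φ⁶ ≤ E`,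
  `E = (36 L_φ² + B_η) ∫∫_{Q₁} (l-Φ)₊^q + ∫∫_{Q₁} 6 η (l-Φ)₊^q φ⁵ |U| ‖Dφ‖`,  `Q₁ = ]t₁,t₀[ × B̄(ρ₁)`

(`‖Dφ‖ ≤ L_φ`): the `|∇Θ|²` and `|η'|` terms are bounded pointwise, the AXIS TERM IS DROPPED BY ITS
SIGN (`moserTheta_props`), and the drift term is kept as the majorant `6 η H(Φ) φ⁵ |U| ‖Dφ‖`
(`|⟪U, ∇Θ²⟩| ≤ 6 φ⁵ |U| ‖Dφ‖`) for the Hölder splitting downstream; `t₂ ↑ t₀` by monotone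
convergence.

* `moser_energy_bounds` — the two bounds above.

## References

* A. I. Nazarov, N. N. Uraltseva, St. Petersburg Math. J. 23 (2012) 93–115 = arXiv:1011.1888,
  §3, Lemma 3.1, (3.2)–(3.3), Remarks 5, 6, 9. [NazarovUraltseva2012]
* G. Seregin, Anal. Math. Phys. 10 (2020), Paper 46 = arXiv:2006.04140, Lemma 2.2. [Seregin2020]
-/

-- the problem directory repeats the summit name (D-0017); core's `dupNamespace` linter fires
set_option linter.dupNamespace false

noncomputable section

open MeasureTheory Set Function Filter Topology Metric
open scoped NNReal ENNReal RealInnerProductSpace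

namespace Summit.NavierStokesRegularity.NavierStokesRegularity.Theorems.AxisymmetricKatoGlobal.EulerScaling

open Literature.Analysis.FluidPDE Literature.Analysis.FluidPDE.LeiZhang2011

/-! ### The energy bounds -/

/-- **N–U (3.2)→(3.3) in the energy class (Seregin's class 𝒱, Remark 9), for the Moser test power.**
Data: `Φ ≥ 0` jointly measurable with `C¹` slices for a.e. `t ∈ ]-R², 0[`, a drift `U`, the energy class `hEC` at level `k` and scale `R` (written out); the cut-off
`φ = radialCutoff ρ₂ ρ₁`, `0 < ρ₂ < ρ₁ < 2R`, `‖Dφ‖ ≤ L_φ`; times `-R² < t₁ < t₀ ≤ 0`; a time weight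
`η ∈ C¹`, `0 ≤ η ≤ 1`, `|η'| ≤ B_η`, with `η(t₁) ∫ (l-Φ(t₁))₊^q φ⁶ = 0`; a level `0 < l ≤ k` and an
exponent `q > 2`. Conclusion, with `Q₁ = ]t₁, t₀[ × B̄(0, ρ₁)` and
`E = (36 L_φ² + B_η) ∫∫_{Q₁} (l-Φ)₊^q + ∫∫_{Q₁} 6 η (l-Φ)₊^q φ⁵ |U| ‖Dφ‖`:
(slices) `∫ η(t) (l-Φ(t,x))₊^q (φ³)² dx ≤ E` for every `t ∈ ]t₁, t₀[`;
(dissipation) `∫∫_{]t₁,t₀[ × ℝ³} ½ η H''(Φ) ‖∇Φ‖² (φ³)² ≤ E`, `H = ((l-·)₊)^q`.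
[cite: NazarovUraltseva2012, proof of Lemma 3.1, (3.2)–(3.3), Remarks 5, 9] -/
theorem moser_energy_bounds
    (Φ : ℝ → EuclideanSpace ℝ (Fin 3) → ℝ)
    (U : ℝ → EuclideanSpace ℝ (Fin 3) → EuclideanSpace ℝ (Fin 3)) (k R : ℝ)
    (hΦm : Measurable (uncurry Φ)) (hΦ0 : ∀ t x, 0 ≤ Φ t x)
    (hEC : ∀ (H : ℝ → ℝ), ContDiff ℝ 2 H → (∀ v, deriv H v ≤ 0) → (∀ v, 0 ≤ H v) →
      (∀ v, 0 ≤ deriv (deriv H) v) → (∀ v, deriv H v ^ 2 ≤ 2 * H v * deriv (deriv H) v) →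
      (∀ v, k ≤ v → H v = 0) →
      ∀ (Θ : EuclideanSpace ℝ (Fin 3) → ℝ), ContDiff ℝ 1 Θ → HasCompactSupport Θ →
        tsupport Θ ⊆ ball (0 : EuclideanSpace ℝ (Fin 3)) (2 * R) →
      ∀ (η : ℝ → ℝ), ContDiff ℝ 1 η → (∀ s, 0 ≤ η s) →
      ∀ (t₁ t₂ : ℝ), -R ^ 2 < t₁ → t₁ ≤ t₂ → t₂ < 0 →
        ENNReal.ofReal (η t₂ * ∫ x, H (Φ t₂ x) * Θ x ^ 2) +
          ∫⁻ z in Icc t₁ t₂ ×ˢ (univ : Set (EuclideanSpace ℝ (Fin 3))), ENNReal.ofReal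
            (1 / 2 * η z.1 * (deriv (deriv H) (Φ z.1 z.2) * ‖gradient (Φ z.1) z.2‖ ^ 2 *
              Θ z.2 ^ 2))
        ≤ ENNReal.ofReal (η t₁ * (∫ x, H (Φ t₁ x) * Θ x ^ 2) +
            (4 * ∫ z in Icc t₁ t₂ ×ˢ (univ : Set (EuclideanSpace ℝ (Fin 3))),
              η z.1 * (H (Φ z.1 z.2) * ‖gradient Θ z.2‖ ^ 2)) +
            (∫ z in Icc t₁ t₂ ×ˢ (univ : Set (EuclideanSpace ℝ (Fin 3))),
              η z.1 * (H (Φ z.1 z.2) * inner ℝ (U z.1 z.2) (gradient (fun y => Θ y ^ 2) z.2))) +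
            (∫ z in Icc t₁ t₂ ×ˢ (univ : Set (EuclideanSpace ℝ (Fin 3))),
              η z.1 * (2 / cylRadius z.2 *
                (H (Φ z.1 z.2) * fderiv ℝ (fun y => Θ y ^ 2) z.2 (eR z.2)))) +
            (∫ z in Icc t₁ t₂ ×ˢ (univ : Set (EuclideanSpace ℝ (Fin 3))),
              |deriv η z.1| * (H (Φ z.1 z.2) * Θ z.2 ^ 2))))
    {ρ₂ ρ₁ t₁ t₀ l q Lφ Bη : ℝ} (hρ₂ : 0 < ρ₂) (hρ₁ : ρ₂ < ρ₁) (hρ₁R : ρ₁ < 2 * R)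
    (ht₁ : -R ^ 2 < t₁) (ht : t₁ < t₀) (ht₀ : t₀ ≤ 0) (hl : 0 < l) (hlk : l ≤ k) (hq : 2 < q)
    {φ : EuclideanSpace ℝ (Fin 3) → ℝ} (hφdef : φ = radialCutoff ρ₂ ρ₁)
    (hLφ : ∀ x, ‖fderiv ℝ φ x‖ ≤ Lφ)
    {η : ℝ → ℝ} (hη : ContDiff ℝ 1 η) (hη01 : ∀ s, 0 ≤ η s ∧ η s ≤ 1) (hBη0 : 0 ≤ Bη)
    (hBη : ∀ s, |deriv η s| ≤ Bη)
    (hinit : η t₁ * (∫ x, max (l - Φ t₁ x) 0 ^ q * (φ x ^ 3) ^ 2) = 0) :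
    (∀ t ∈ Ioo t₁ t₀,
      ∫⁻ x, ENNReal.ofReal (η t * max (l - Φ t x) 0 ^ q * (φ x ^ 3) ^ 2) ≤
        ENNReal.ofReal (36 * Lφ ^ 2 + Bη) *
            (∫⁻ z in Ioo t₁ t₀ ×ˢ closedBall (0 : EuclideanSpace ℝ (Fin 3)) ρ₁,
              ENNReal.ofReal (max (l - Φ z.1 z.2) 0 ^ q)) +
          ∫⁻ z in Ioo t₁ t₀ ×ˢ closedBall (0 : EuclideanSpace ℝ (Fin 3)) ρ₁,
            ENNReal.ofReal (6 * (η z.1 * max (l - Φ z.1 z.2) 0 ^ q) * φ z.2 ^ 5 *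
              ‖U z.1 z.2‖ * ‖fderiv ℝ φ z.2‖)) ∧
    ∫⁻ z in Ioo t₁ t₀ ×ˢ (univ : Set (EuclideanSpace ℝ (Fin 3))), ENNReal.ofReal
        (1 / 2 * η z.1 * (deriv (deriv fun τ : ℝ => max (l - τ) 0 ^ q) (Φ z.1 z.2) *
          ‖gradient (Φ z.1) z.2‖ ^ 2 * (φ z.2 ^ 3) ^ 2)) ≤
      ENNReal.ofReal (36 * Lφ ^ 2 + Bη) *
          (∫⁻ z in Ioo t₁ t₀ ×ˢ closedBall (0 : EuclideanSpace ℝ (Fin 3)) ρ₁,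
            ENNReal.ofReal (max (l - Φ z.1 z.2) 0 ^ q)) +
        ∫⁻ z in Ioo t₁ t₀ ×ˢ closedBall (0 : EuclideanSpace ℝ (Fin 3)) ρ₁,
          ENNReal.ofReal (6 * (η z.1 * max (l - Φ z.1 z.2) 0 ^ q) * φ z.2 ^ 5 *
            ‖U z.1 z.2‖ * ‖fderiv ℝ φ z.2‖) := by
  have hstep := moser_energy_step Φ U k R hΦm hEC hρ₂ hρ₁ hρ₁R ht₁ ht₀ hl hlk hq hφdef hLφ hη
    hη01 hBη0 hBη hinit
  set E : ℝ≥0∞ := ENNReal.ofReal (36 * Lφ ^ 2 + Bη) *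
      (∫⁻ z in Ioo t₁ t₀ ×ˢ closedBall (0 : EuclideanSpace ℝ (Fin 3)) ρ₁,
        ENNReal.ofReal (max (l - Φ z.1 z.2) 0 ^ q)) +
    ∫⁻ z in Ioo t₁ t₀ ×ˢ closedBall (0 : EuclideanSpace ℝ (Fin 3)) ρ₁,
      ENNReal.ofReal (6 * (η z.1 * max (l - Φ z.1 z.2) 0 ^ q) * φ z.2 ^ 5 *
        ‖U z.1 z.2‖ * ‖fderiv ℝ φ z.2‖) with hE
  set K : Set (EuclideanSpace ℝ (Fin 3)) := closedBall (0 : EuclideanSpace ℝ (Fin 3)) ρ₁ with hK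
  set H : ℝ → ℝ := fun τ => max (l - τ) 0 ^ q with hH
  obtain ⟨-, -, hH0, -, -, -, hHle, -⟩ := powerTest_energyClass_props hq hl.le
  set Θ : EuclideanSpace ℝ (Fin 3) → ℝ := fun y => φ y ^ 3 with hΘ
  obtain ⟨-, -, -, hφ01, -, -, -, -⟩ := moserTheta_props hρ₂.le hρ₁ hφdef
  have hφK : ∀ x, x ∉ K → φ x = 0 := fun x hx => by
    rw [hφdef]
    exact radialCutoff_eq_zero hρ₂.le hρ₁ (le_of_lt (by simpa [hK, mem_closedBall_zero_iff] using hx))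
  have hη0 : ∀ s, 0 ≤ η s := fun s => (hη01 s).1
  ----------------------------------------------------------------
  -- (1) the slice bound
  ----------------------------------------------------------------
  have hslice : ∀ t ∈ Ioo t₁ t₀,
      ∫⁻ x, ENNReal.ofReal (η t * max (l - Φ t x) 0 ^ q * (φ x ^ 3) ^ 2) ≤ E := by
    intro t htI
    have hΦt : Measurable (Φ t) := hΦm.comp (measurable_const.prodMk measurable_id)
    have hφc : Continuous φ := by
      rw [hφdef]; exact (radialCutoff_contDiff ρ₂ ρ₁ (n := 1)).continuous
    set f : EuclideanSpace ℝ (Fin 3) → ℝ := fun x => H (Φ t x) * Θ x ^ 2 with hf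
    have hf0 : ∀ x, 0 ≤ f x := fun x => mul_nonneg (hH0 _) (sq_nonneg _)
    have hfm : AEStronglyMeasurable f volume := by
      refine (Measurable.mul ?_ ((hφc.pow 3).pow 2).measurable).aestronglyMeasurable
      exact ((measurable_const.sub hΦt).max measurable_const).pow_const _
    have hfK : ∀ x, x ∉ K → f x = 0 := fun x hx => by
      show H (Φ t x) * (φ x ^ 3) ^ 2 = 0
      rw [hφK x hx]; simp
    have hfle : ∀ x, ‖f x‖ ≤ l ^ q := fun x => by
      rw [Real.norm_of_nonneg (hf0 x)]
      have h1 : H (Φ t x) ≤ l ^ q := hHle _ (hΦ0 _ _)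
      have h2 : (φ x ^ 3) ^ 2 ≤ 1 :=
        pow_le_one₀ (pow_nonneg (hφ01 _).1 3) (pow_le_one₀ (hφ01 _).1 (hφ01 _).2)
      calc H (Φ t x) * Θ x ^ 2 ≤ l ^ q * 1 := mul_le_mul h1 h2 (sq_nonneg _) (by positivity)
        _ = l ^ q := mul_one _
    have hfint : Integrable f volume := by
      have hsupp : support f ⊆ K := fun x hx => by
        by_contra h; exact hx (hfK x h)
      rw [← integrableOn_iff_integrable_of_support_subset hsupp]
      exact Measure.integrableOn_of_bounded measure_closedBall_lt_top.ne hfm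
        (ae_of_all _ fun x => hfle x)
    have hconv : ∫⁻ x, ENNReal.ofReal (η t * max (l - Φ t x) 0 ^ q * (φ x ^ 3) ^ 2) =
        ENNReal.ofReal (η t * ∫ x, H (Φ t x) * Θ x ^ 2) := by
      have e1 : (fun x => ENNReal.ofReal (η t * max (l - Φ t x) 0 ^ q * (φ x ^ 3) ^ 2)) =
          fun x => ENNReal.ofReal (η t * f x) := by
        funext x; congr 1; simp only [hf, hH, hΘ]; ring
      rw [e1, ← integral_const_mul, ofReal_integral_eq_lintegral_ofReal (hfint.const_mul _)
        (ae_of_all _ fun x => mul_nonneg (hη0 _) (hf0 x))]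
    rw [hconv]
    exact le_trans le_self_add (hstep t htI.1 htI.2)
  ----------------------------------------------------------------
  -- (2) the dissipation bound: `t₂ ↑ t₀`
  ----------------------------------------------------------------
  have hdiss_t : ∀ t₂, t₁ < t₂ → t₂ < t₀ →
      ∫⁻ z in Icc t₁ t₂ ×ˢ (univ : Set (EuclideanSpace ℝ (Fin 3))), ENNReal.ofReal
        (1 / 2 * η z.1 * (deriv (deriv fun τ : ℝ => max (l - τ) 0 ^ q) (Φ z.1 z.2) *
          ‖gradient (Φ z.1) z.2‖ ^ 2 * (φ z.2 ^ 3) ^ 2)) ≤ E := fun t₂ h12 h20 =>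
    le_trans le_add_self (hstep t₂ h12 h20)
  obtain ⟨htn, hsup⟩ := setLIntegral_Ioo_prod_inter_le_iSup ht
    (univ : Set (EuclideanSpace ℝ (Fin 3))) (univ : Set (ℝ × EuclideanSpace ℝ (Fin 3)))
    (fun z => ENNReal.ofReal
      (1 / 2 * η z.1 * (deriv (deriv fun τ : ℝ => max (l - τ) 0 ^ q) (Φ z.1 z.2) *
        ‖gradient (Φ z.1) z.2‖ ^ 2 * (φ z.2 ^ 3) ^ 2)))
  simp only [inter_univ] at hsup
  have hdiss : ∫⁻ z in Ioo t₁ t₀ ×ˢ (univ : Set (EuclideanSpace ℝ (Fin 3))), ENNReal.ofReal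
      (1 / 2 * η z.1 * (deriv (deriv fun τ : ℝ => max (l - τ) 0 ^ q) (Φ z.1 z.2) *
        ‖gradient (Φ z.1) z.2‖ ^ 2 * (φ z.2 ^ 3) ^ 2)) ≤ E := by
    refine hsup.trans (iSup_le fun n => ?_)
    obtain ⟨-, h2⟩ := htn n
    have hlt : t₁ < t₀ - (t₀ - t₁) / ((n : ℝ) + 2) := by
      have hpos : 0 < t₀ - t₁ := sub_pos.2 ht
      have h1 : (t₀ - t₁) / ((n : ℝ) + 2) < t₀ - t₁ :=
        div_lt_self hpos (by have := Nat.cast_nonneg (α := ℝ) n; linarith)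
      linarith
    exact hdiss_t _ hlt h2
  exact ⟨hslice, hdiss⟩

end Summit.NavierStokesRegularity.NavierStokesRegularity.Theorems.AxisymmetricKatoGlobal.EulerScaling

end
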